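import Mathlib
import Summits.ResolutionOfSingularities.ResolutionOfSingularities.Theorems.RadicialJungCleanModelsCleanPermSeqStages
import Literature.AlgebraicGeometry.Resolution.PointCentrePermissible
import HarnessLib

/-!
# Route `RadicialJung`, crux `CleanModels` (stmt-ResolutionOfSingularities-15917), line `Sketch` rev 35, stub 6 `stub_cleanProp44` (X44c):
# the POINT-CENTRE STEP of [CoP1] Prop. 4.4 (clean version) from base data — companion of the curve-centre step

Memo `Cruxes/CleanModels/Lines/Sketch-memo-hand2-g10-stubs-5-7.md` §3 («HOW O6 CALLS IT»).  With ✓ `exists_isCleanPermissibleSeq_blowup_curve_of_base`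
(`…CleanPermSeqStages.lean`) O6 has the curve-centre move of [CoP1] Prop. 4.4 in X44c's output currency; this file packages the (free) point-centre
move the same way: inside a clean-permissible sequence `π : X₁ → X` for `(J, μ)` over a Noetherian regular quasi-excellent `X` (line of `G`
clean-regular everywhere, `char p`), the blowing up `τ` of a closed point `x ∈ X₁` of the stratum `{ord J₁ = μ}` (with `𝒪_{X₁,x}` not a field)
extends the sequence (✓ `IsCleanPermissibleSeq.cons_point`: closed points are clean-permissible centres because the line is clean-REGULAR there,
✓ `IsCleanPermissibleSeq.cleanRegAt`), the controlled transform has order `≤ μ` (✓ `IsBlowup.idealOrder_controlledTransform_le_of_forall`), and the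
new top is Noetherian integral (`exists_isCleanPermissibleSeq_blowup_point_of_base`).

Honest framing: OURS (bookkeeping); nothing here proves X44c or any case of `CleanModels`.
-/

noncomputable section

set_option linter.dupNamespace false -- mandated namespace of this single-conjunct summit

open CategoryTheory AlgebraicGeometry TopologicalSpace IsLocalRing Opposite
open Literature.AlgebraicGeometry.Resolution Literature.AlgebraicGeometry.Motives
open Scheme.IdealSheafData

namespace Summit.ResolutionOfSingularities.ResolutionOfSingularities.Theorems.RadicialJung.CleanModels

/-- Stage data along a clean-permissible sequence, without the dimension bound: the top is locally Noetherian, regular, quasi-excellent and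
proper over the base. [cite: Liu2002, Thm. 8.1.19 (a)] [cite: StacksProject, Tag 07QU] -/
theorem IsCleanPermissibleSeq.stage_data' {p : ℕ} {X' X : Scheme.{0}} [IsIntegral X'] [IsIntegral X] {π : X' ⟶ X} [IsDominant π]
    {J : X.IdealSheafData} {μ : ℕ} {J' : X'.IdealSheafData} {G : X.functionField} (h : IsCleanPermissibleSeq p π J μ J' G) :
    IsLocallyNoetherian X → Scheme.IsRegular X → Scheme.IsQuasiExcellent X →
      IsLocallyNoetherian X' ∧ Scheme.IsRegular X' ∧ Scheme.IsQuasiExcellent X' ∧ IsProper π := by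
  induction h with
  | nil J μ G => exact fun hN hX hE => ⟨hN, hX, hE, inferInstance⟩
  | @cons X'' X' X _ _ _ τ _ π _ J μ J' G Y hπ hint hreg hY hτ hperm ih =>
    intro hN hX hE
    haveI := hN
    obtain ⟨hN', hR', hE', hP'⟩ := ih hN hX hE
    haveI := hN'
    haveI := hP'
    haveI : IsProper τ := hτ.isProper
    haveI : IsLocallyNoetherian X'' := LocallyOfFiniteType.isLocallyNoetherian τ
    exact ⟨inferInstance, hτ.isRegular_of_isRegular_subscheme hR' hreg, hτ.isQuasiExcellent hE', inferInstance⟩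

/-- **The point-centre step of [CoP1] Prop. 4.4 (clean version) from base data.**  See the module docstring.
[cite: CossartPiltant2008, proof of Prop. 4.2] [cite: CossartPiltant2008, Prop. 4.2 (a)] [cite: Piltant2013, §2 Axiom 2 (ii)] -/
theorem exists_isCleanPermissibleSeq_blowup_point_of_base (p : ℕ) [hp : Fact p.Prime] {X X₁ : Scheme.{0}} [IsIntegral X] [IsNoetherian X]
    [IsIntegral X₁] {π : X₁ ⟶ X} [IsDominant π] {J : X.IdealSheafData} {μ : ℕ} {J₁ : X₁.IdealSheafData} {G : X.functionField}
    [CharP X.functionField p] (hπ : IsCleanPermissibleSeq p π J μ J₁ G)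
    (hG : ∀ x : X, CleanRegAt p (algebraMap (X.presheaf.stalk x) X.functionField) G) (hX : Scheme.IsRegular X)
    (hE : Scheme.IsQuasiExcellent X) (hJ₁le : ∀ x : X₁, idealOrder J₁ x ≤ μ) {x : X₁} (hx : IsClosed ({x} : Set X₁))
    (hord : idealOrder J₁ x = μ) (hmx : maximalIdeal (X₁.presheaf.stalk x) ≠ ⊥) :
    ∃ (X'' : Scheme.{0}) (_ : IsIntegral X'') (_ : IsNoetherian X'') (τ : X'' ⟶ X₁) (_ : IsDominant τ),
      IsBlowup τ (vanishingIdeal (⟨{x}, hx⟩ : Closeds X₁)) ∧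
      IsCleanPermissibleSeq p (τ ≫ π) J μ (controlledTransform τ (vanishingIdeal (⟨{x}, hx⟩ : Closeds X₁)) J₁ μ) G ∧
      ∀ x'' : X'', idealOrder (controlledTransform τ (vanishingIdeal (⟨{x}, hx⟩ : Closeds X₁)) J₁ μ) x'' ≤ μ := by
  obtain ⟨hN₁, hX₁, -, hP₁⟩ := hπ.stage_data' inferInstance hX hE
  haveI := hN₁
  haveI := hP₁
  haveI : CompactSpace X₁ := QuasiCompact.compactSpace_of_compactSpace π
  haveI : IsNoetherian X₁ := {}
  set Y : Closeds X₁ := ⟨{x}, hx⟩ with hYdef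
  have hYbot : vanishingIdeal Y ≠ ⊥ := by
    intro hbot
    apply hmx
    rw [← stalkIdeal_vanishingIdeal_singleton hx, ← hYdef, hbot, stalkIdeal_bot]
  have hint : IsIntegral (vanishingIdeal Y).subscheme := isIntegral_subscheme_vanishingIdeal_singleton hx
  have hreg : Scheme.IsRegular (vanishingIdeal Y).subscheme := isRegular_subscheme_vanishingIdeal_singleton hx
  set τ := blowup.π (vanishingIdeal Y) with hτdef
  have hτ : IsBlowup τ (vanishingIdeal Y) := blowup.isBlowup _
  haveI : IsIntegral (blowup (vanishingIdeal Y)) := hτ.isIntegral hYbot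
  haveI : IsDominant τ := isDominant_of_isBlowup_of_ne_bot hτ hYbot
  haveI : IsProper τ := hτ.isProper
  haveI : CompactSpace (blowup (vanishingIdeal Y)) := QuasiCompact.compactSpace_of_compactSpace τ
  haveI : IsLocallyNoetherian (blowup (vanishingIdeal Y)) := LocallyOfFiniteType.isLocallyNoetherian τ
  haveI : IsNoetherian (blowup (vanishingIdeal Y)) := {}
  have hclean := hπ.cleanRegAt hp.out inferInstance hG x
  have hcons : IsCleanPermissibleSeq p (τ ≫ π) J μ (controlledTransform τ (vanishingIdeal Y) J₁ μ) G :=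
    IsCleanPermissibleSeq.cons_point hp.out τ π J μ J₁ G hπ x hx hint hreg hord hτ hclean
  have hY : ∀ y ∈ (Y : Set X₁), idealOrder J₁ y = μ := by
    intro y hy
    have hy' : y = x := hy
    subst hy'
    exact hord
  have hle : ∀ x'', idealOrder (controlledTransform τ (vanishingIdeal Y) J₁ μ) x'' ≤ μ :=
    fun x'' => hτ.idealOrder_controlledTransform_le_of_forall hX₁ hreg hY hJ₁le x''
  exact ⟨blowup (vanishingIdeal Y), inferInstance, inferInstance, τ, inferInstance, hτ, hcons, hle⟩

end Summit.ResolutionOfSingularities.ResolutionOfSingularities.Theorems.RadicialJung.CleanModels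

end
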